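import Literature.NumberTheory.LFunctions.BondarenkoHeap2026Section6Proofs
import HarnessLib

/-!
# Bondarenko–Heap 2026, Lemma 9, (30)–(31): the exact evaluation of `T_ψ(r m̄)` — PROVED

Topic `Literature/NumberTheory/LFunctions`, namespace
`Literature.NumberTheory.LFunctions.BondarenkoHeap2026` (helpers in `….JacobiSums`). PROOF LAYER,
RH-FREE, theorems only (no definition, no named fact, no `sorry`): this file discharges the named
fact `lemma9_exact` of `BondarenkoHeap2026Section6.lean` (A. Bondarenko, W. Heap, *Siegel zeros and
small gaps between zeros of the Riemann zeta function*, arXiv:2608.07399v1, Lemma 9, eq. (30)–(31),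
TeX l.1026–1048, proof l.1065–1100):

`theorem lemma9_exact_holds : lemma9_exact`.

NOT RH-BEARING (cell rh-crit C5; LADDER-RH §4 HELD «conditional bridges: exceptional zero ⇒ …»):
an exact evaluation of a complete character sum modulo an odd square-free integer — finite-field
algebra; it says nothing about `ζ`, its zeros, Siegel zeros or RH.

## The statement, as printed (TeX l.1026–1048) and as typed (`BondarenkoHeap2026Section6.lean`)

Printed (verbatim, TeX l.1026–1043): "Suppose $q$ is odd and square-free and decompose
$\psi=\prod_{p\mid q}\psi_p$. Let (29) $s_\psi=\prod_{p\mid q, \psi_p=\chi_p} p$, $q_\psi=q/s_\psi$,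
$\lambda_\psi=(\chi\bar\psi)|_{q_\psi}$. Then (30)
$T_\psi(r\bar m)= J_{q_\psi}(\psi)\lambda_\psi(r) \overline{\lambda_\psi(m)}c_{s_\psi}(r)$, where
$c_s$ is the Ramanujan sum and (31) $|J_{q_\psi}(\psi)|\leqs\sqrt{q_\psi}$. For $\psi=\psi_0$ or
$\chi$, we have $|J_{q_\psi}(\psi)|\leqs 1$." ((32), l.1043–1048, is the tree's separate fact
`lemma9_bound`, already PROVED as `lemma9_bound_holds`.)

Typed: for `q` odd and square-free, `χ` the primitive quadratic character mod `q`, `ψ` any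
character mod `q`, with `T_ψ(y) = ∑*_{u mod q} χ(u + y) ψ̄(u)` (`genJacobiSum`), `q_ψ = cond(χψ̄)`
(`jacobiConductor`), `s_ψ = q/q_ψ` (`jacobiComplement`), `λ_ψ = (χψ̄)|_{q_ψ}` the primitive
character inducing `χψ̄` (`jacobiTwist`) and `J_{q_ψ}(ψ) := μ(s_ψ) T_ψ(1)` (`jacobiFactor`):
(30) `T_ψ(r m̄) = J_{q_ψ}(ψ) λ_ψ(r) conj(λ_ψ(m)) c_{s_ψ}(r)` for `(m, q) = 1`, (31) `|J_{q_ψ}(ψ)| ≤ √q_ψ`,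
and `|J_{q_ψ}(ψ)| ≤ 1` for `ψ ∈ {ψ₀, χ}`.

## Why the fact is TRUE AS TYPED (hand-check of the local/global dictionary, cell ruling R-g6-38 (a))

The printed proof (verbatim, TeX l.1065–1086): "Recall that
$T_\psi(r\bar m)=\sideset{}{^*}\sum_{u\bmod q}\chi(u+r\bar m)\ol{\psi(u)}$. By the Chinese Remainder
Theorem everything here factors prime by prime. If $p\nmid r$, we scale $u$ by $r\bar m$ so that
the local sum is a Jacobi sum $\sideset{}{^*}\sum_{u\bmod p}\chi_p(u+1)\ol{\psi_p(u)}$ times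
$(\chi_p\bar\psi_p)(r\bar m)$. If $\psi_p\ne\chi_p$, the Jacobi factor has absolute value at most
$\sqrt p$ by the well-known beta function analogy … If $\psi_p=\chi_p$, the local factor is $-1$
when $p\nmid r$ and $p-1$ when $p\mid r$, which is exactly $c_p(r)$. If $p\mid r$ but
$\psi_p\ne\chi_p$, both sides of (30) vanish. This proves (30) and (31)." (TeX l.1087–1092.)

Dictionary, prime by prime (`q` square-free, `χ_p` the Legendre symbol, `J_p := ∑*_{u mod p}
χ_p(u+1) ψ̄_p(u)`): `ψ_p = χ_p` ⇒ local factor `∑_u χ_p(u² + u y) = c_p(y)` and `p ∣ s_ψ`;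
`ψ_p ≠ χ_p` ⇒ `λ_p := χ_p ψ̄_p` is non-trivial mod `p`, local factor `λ_p(y) · J_p` (at `p ∣ y`
it is `∑*_u λ_p(u) = 0`), `p ∣ q_ψ`, and `|J_p| = 1` if `ψ_p = 1` (`J_p = −1`), `|J_p| = √p`
otherwise (genuine Jacobi sum). Globally: `cond(χψ̄) = ∏_{ψ_p ≠ χ_p} p = q_ψ` — so the tree's
`jacobiConductor := (χψ⁻¹).conductor` and `jacobiComplement := q / q_ψ` ARE the printed
`q_ψ, s_ψ`; the primitive character inducing `χψ̄` is `∏_{p ∣ q_ψ} λ_p` — the tree's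
`jacobiTwist := (χψ⁻¹).primitiveCharacter`; and `T_ψ(1) = c_{s_ψ}(1) ∏_{p ∣ q_ψ} J_p =
μ(s_ψ) ∏ J_p`, so the printed `J_{q_ψ}(ψ) = ∏_{p ∣ q_ψ} J_p` equals `μ(s_ψ) T_ψ(1)` — the tree's
`jacobiFactor`. Special characters: `ψ = ψ₀` ⇒ every `J_p = −1`, `|J| = 1`; `ψ = χ` ⇒ `q_ψ = 1`,
`s_ψ = q`, `J = μ(q) T_χ(1) = μ(q) c_q(1) = μ(q)² = 1`. No clause is false as typed (the unused
printed restriction `r ≠ 0` is harmless: `c_s(0) = φ(s)` and (30) holds at `r = 0` too).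

## Proof (the printed road "by the Chinese remainder theorem `T_ψ` factorises; evaluate locally",
TeX l.1065–1100, organised around ONE coprime splitting `q = s_ψ · q_ψ`)

Write `θ = χψ̄`, `f(y) = T_ψ(y) = ∑_{m mod q} ψ̄(m) χ(m + y)` (`genJacobiSum_eq_shiftSum`).

1. *Unit twist* (`JacobiSums.shiftSum_unit_mul`): `f(v y) = θ(v) f(y)` for every unit `v`
   (substitute `m ↦ v m`). Hence `f(r m̄) = conj(θ(m)) f(r) = conj(λ_ψ(m)) f(r)`.
2. *Primitive twist* (`JacobiSums.shiftSum_eq_zero_of_not_isUnit`,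
   `….shiftSum_eq_mul_apply_of_isPrimitive`): if `θ` is primitive mod `n` then
   `f(y) = θ(y) f(1)` for every residue `y` — for a unit by 1., and for a non-unit `y` the
   stabiliser `{v ≡ 1 (mod n/(y,n))}` of `y` carries a `v` with `θ(v) ≠ 1` (primitivity, via
   Mathlib's `factorsThrough_iff_ker_unitsMap`), so `f(y) = θ(v) f(y)` forces `f(y) = 0 = θ(y)`.
3. *Quadratic self-correlation* (`JacobiSums.shiftSum_quad_quad_eq_ramanujanSum`): for the
   primitive quadratic `χ` mod an odd `s`, `∑_{m mod s} χ(m) χ(m + r) = c_s(r)` (Ramanujan's sum) —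
   induction over the factorisation of `s` (tree: `shiftSum_eq_mul_of_coprime`,
   `isPrimitive_crtFst/Snd`, the odd-prime value `sum_quad_quad_shift`, and the tree's
   `ramanujanSum_prime`, `ramanujanSum_mul_of_coprime`).
4. *Splitting `q = s_ψ · q_ψ`* (`JacobiSums.lemma9_exact_aux`): since `θ` factors through
   `q_ψ = cond θ`, its CRT component mod `s_ψ` is trivial (`crtFst_eq_one_of_factorsThrough`), so
   `ψ_{s_ψ} = χ_{s_ψ}`, and `θ` is the lift of its component `θ_{q_ψ}` mod `q_ψ`
   (`eq_changeLevel_crtSnd_of_crtFst_eq_one`), which is therefore primitive with the same values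
   as `λ_ψ` (`primitiveCharacter_apply_eq_of_eq_changeLevel`). By `shiftSum_eq_mul_of_coprime`,
   3. and 2.: `f(r) = c_{s_ψ}(r) · λ_ψ(r) · f_{q_ψ}(1)` and `f(1) = μ(s_ψ) f_{q_ψ}(1)`, so
   `J_{q_ψ}(ψ) = μ(s_ψ)² f_{q_ψ}(1) = f_{q_ψ}(1)` (`s_ψ` square-free) and (30) follows from 1.
5. (31): `|f_{q_ψ}(1)| ≤ √q_ψ`, and `≤ 1` when `ψ ∈ {ψ₀, χ}`, is the tree's CRT bound
   `norm_shiftSum_quad_le_aux` (local Jacobi sums, `BondarenkoHeap2026Section6Proofs.lean`) at the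
   modulus `q_ψ`.

Deviation from print: the source decomposes `ψ = ∏_p ψ_p` over all primes of `q`; here the only
decomposition needed is the coprime pair `(s_ψ, q_ψ)` plus the prime-by-prime induction inside 3.,
because the `q_ψ`-part is evaluated by primitivity alone (step 2) rather than by local Jacobi sums —
the local values enter only through the bound (31), already in the tree.

## References

* [BondarenkoHeap2026] A. Bondarenko, W. Heap, arXiv:2608.07399v1, §6.5, Lemma 9, eq. (29)–(31),
  TeX l.1026–1048; proof l.1065–1100 ("By the Chinese Remainder Theorem everything here factors
  prime by prime … the Jacobi factor has absolute value at most `√p`").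
* [MontgomeryVaughan2007] H. L. Montgomery, R. C. Vaughan, *Multiplicative Number Theory I*,
  CUP 2007, §9.1 (induced modulus, primitive characters), Lemma 9.3 (CRT components), Thm 4.1
  (Ramanujan's sum).
-/

noncomputable section

open Finset DirichletCharacter
open scoped ArithmeticFunction.Moebius ComplexConjugate

namespace Literature.NumberTheory.LFunctions.BondarenkoHeap2026

open Literature.NumberTheory.Sieve (ramanujanSum)

namespace JacobiSums

/-! ### A. Chinese-remainder bookkeeping for Dirichlet characters mod `a b`, `(a, b) = 1` -/

section CRT

variable {a b : ℕ}

/-- Reduction mod `a` of the CRT lift of `(u, v)` is `u`. [cite: MontgomeryVaughan2007, Lemma 9.3] -/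
theorem cast_symm_fst (h : a.Coprime b) (u : ZMod a) (v : ZMod b) :
    (ZMod.cast ((ZMod.chineseRemainder h).symm (u, v)) : ZMod a) = u := by
  have key := PrimitiveQuadratic.chineseRemainder_apply h ((ZMod.chineseRemainder h).symm (u, v))
  rw [RingEquiv.apply_symm_apply] at key
  exact (Prod.ext_iff.mp key).1.symm

/-- Reduction mod `b` of the CRT lift of `(u, v)` is `v`. [cite: MontgomeryVaughan2007, Lemma 9.3] -/
theorem cast_symm_snd (h : a.Coprime b) (u : ZMod a) (v : ZMod b) :
    (ZMod.cast ((ZMod.chineseRemainder h).symm (u, v)) : ZMod b) = v := by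
  have key := PrimitiveQuadratic.chineseRemainder_apply h ((ZMod.chineseRemainder h).symm (u, v))
  rw [RingEquiv.apply_symm_apply] at key
  exact (Prod.ext_iff.mp key).2.symm

/-- The first CRT component is multiplicative in the character.
[cite: MontgomeryVaughan2007, Lemma 9.3] -/
theorem crtFst_mul (h : a.Coprime b) (χ ψ : DirichletCharacter ℂ (a * b)) :
    crtFst h (χ * ψ) = crtFst h χ * crtFst h ψ := by
  refine MulChar.ext fun u => ?_
  rw [MulChar.mul_apply, crtFst_apply, crtFst_apply, crtFst_apply, MulChar.mul_apply]

/-- The second CRT component is multiplicative in the character.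
[cite: MontgomeryVaughan2007, Lemma 9.3] -/
theorem crtSnd_mul (h : a.Coprime b) (χ ψ : DirichletCharacter ℂ (a * b)) :
    crtSnd h (χ * ψ) = crtSnd h χ * crtSnd h ψ := by
  refine MulChar.ext fun v => ?_
  rw [MulChar.mul_apply, crtSnd_apply, crtSnd_apply, crtSnd_apply, MulChar.mul_apply]

/-- The first CRT component of `ψ⁻¹` is the inverse of that of `ψ`.
[cite: MontgomeryVaughan2007, Lemma 9.3] -/
theorem crtFst_inv (h : a.Coprime b) (ψ : DirichletCharacter ℂ (a * b)) :
    crtFst h ψ⁻¹ = (crtFst h ψ)⁻¹ := by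
  refine MulChar.ext fun u => ?_
  rw [crtFst_apply, MulChar.inv_apply_eq_inv', MulChar.inv_apply_eq_inv', crtFst_apply]

/-- **A character mod `a b` that factors through `b` has trivial component mod `a`**
(`χ_a(u) = χ(x)` with `x ≡ u (a)`, `x ≡ 1 (b)`, and `χ(x)` only depends on `x mod b`).
[cite: MontgomeryVaughan2007, §9.1 and Lemma 9.3] -/
theorem crtFst_eq_one_of_factorsThrough [NeZero a] [NeZero b] (h : a.Coprime b)
    {θ : DirichletCharacter ℂ (a * b)} (hθ : θ.FactorsThrough b) : crtFst h θ = 1 := by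
  obtain ⟨hb, θ₀, hθ₀⟩ := hθ
  refine MulChar.ext fun u => ?_
  have hx : IsUnit ((ZMod.chineseRemainder h).symm ((u : ZMod a), 1)) :=
    isUnit_symm_mk_one h u.isUnit
  rw [MulChar.one_apply_coe, crtFst_apply, hθ₀, ← hx.unit_spec,
    changeLevel_eq_cast_of_dvd θ₀ hb, hx.unit_spec, cast_symm_snd h, map_one]

/-- **A character mod `a b` with trivial component mod `a` is the lift of its component mod `b`.**
[cite: MontgomeryVaughan2007, Lemma 9.3] -/
theorem eq_changeLevel_crtSnd_of_crtFst_eq_one [NeZero a] [NeZero b] (h : a.Coprime b)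
    {θ : DirichletCharacter ℂ (a * b)} (h1 : crtFst h θ = 1) :
    θ = changeLevel (dvd_mul_left b a) (crtSnd h θ) := by
  refine MulChar.ext fun x => ?_
  have hxa : IsUnit (ZMod.cast (x : ZMod (a * b)) : ZMod a) := by
    rw [← ZMod.unitsMap_val (dvd_mul_right a b) x]
    exact Units.isUnit _
  rw [changeLevel_eq_cast_of_dvd (crtSnd h θ) (dvd_mul_left b a), apply_eq_crtFst_mul_crtSnd h θ,
    h1, MulChar.one_apply hxa, one_mul]

end CRT

/-! ### B. Primitive characters: values of `primitiveCharacter` -/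

/-- For a primitive `θ` mod `n`, `θ.primitiveCharacter` takes the same values as `θ` on `ℤ`.
[cite: MontgomeryVaughan2007, §9.1] -/
theorem primitiveCharacter_apply_of_isPrimitive {n : ℕ} [NeZero n] {θ : DirichletCharacter ℂ n}
    (hθ : θ.IsPrimitive) (r : ℤ) : θ.primitiveCharacter r = θ r := by
  have hc : θ.conductor = n := hθ
  by_cases hr : IsCoprime r n
  · exact θ.primitiveCharacter_apply_of_isCoprime hr
  · rw [(θ.apply_eq_zero_iff r).mpr hr,
      (θ.primitiveCharacter.apply_eq_zero_iff r).mpr (by rwa [hc])]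

/-- If `θ` (mod `n`) is the lift of a PRIMITIVE character `θ₀` mod `d ∣ n`, then
`θ.primitiveCharacter` takes the same values as `θ₀` on `ℤ` ("the primitive character inducing
`θ` is unique"). [cite: MontgomeryVaughan2007, §9.1] -/
theorem primitiveCharacter_apply_eq_of_eq_changeLevel {n d : ℕ} [NeZero n]
    {θ : DirichletCharacter ℂ n} (hd : d ∣ n) {θ₀ : DirichletCharacter ℂ d}
    (h : θ = changeLevel hd θ₀) (h₀ : θ₀.IsPrimitive) (r : ℤ) :
    θ.primitiveCharacter r = θ₀ r := by
  subst h
  haveI : NeZero d :=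
    ⟨fun h0 => NeZero.ne n (Nat.eq_zero_of_zero_dvd (by rwa [h0] at hd))⟩
  rw [primitiveCharacter_changeLevel_apply hd θ₀ r, primitiveCharacter_apply_of_isPrimitive h₀]

/-! ### C. Twisting a complete shifted sum by units; the primitive case -/

section Twist

variable {n : ℕ} [NeZero n]

/-- **Unit twist**: `∑_m ψ₁(m) ψ₂(m + v y) = (ψ₁ψ₂)(v) ∑_m ψ₁(m) ψ₂(m + y)` for a unit `v`
(substitute `m ↦ v m`). [cite: BondarenkoHeap2026, Lemma 9 (proof), TeX l.1069–1075] -/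
theorem shiftSum_unit_mul (ψ₁ ψ₂ : DirichletCharacter ℂ n) (v : (ZMod n)ˣ) (y : ZMod n) :
    shiftSum ψ₁ ψ₂ 1 ((v : ZMod n) * y) = (ψ₁ * ψ₂) (v : ZMod n) * shiftSum ψ₁ ψ₂ 1 y := by
  rw [shiftSum_def, shiftSum_def, Finset.mul_sum]
  refine (Fintype.sum_equiv (Units.mulLeft v) _ _ fun m => ?_).symm
  simp only [Units.mulLeft_apply, one_mul, MulChar.mul_apply]
  rw [show (v : ZMod n) * m + (v : ZMod n) * y = (v : ZMod n) * (m + y) by ring, map_mul, map_mul]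
  ring

/-- **Primitive twist, non-units**: if `ψ₁ψ₂` is primitive mod `n` and `y` is NOT a unit, then
`∑_m ψ₁(m) ψ₂(m + y) = 0`: the stabiliser `{v ≡ 1 (mod n/(y,n))}` of `y` contains a unit `v`
with `(ψ₁ψ₂)(v) ≠ 1` (primitivity), and the unit twist gives `S = (ψ₁ψ₂)(v) S`.
[cite: MontgomeryVaughan2007, §9.1] -/
theorem shiftSum_eq_zero_of_not_isUnit (ψ₁ ψ₂ : DirichletCharacter ℂ n)
    (hprim : (ψ₁ * ψ₂).IsPrimitive) {y : ZMod n} (hy : ¬IsUnit y) :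
    shiftSum ψ₁ ψ₂ 1 y = 0 := by
  have hc : (ψ₁ * ψ₂).conductor = n := hprim
  have hn0 : n ≠ 0 := NeZero.ne n
  -- the gcd `g = (y, n) ≠ 1` and the complementary divisor `e = n / g < n`
  have hgy : Nat.gcd y.val n ∣ y.val := Nat.gcd_dvd_left _ _
  have hg1 : Nat.gcd y.val n ≠ 1 := by
    intro h1
    apply hy
    rw [← ZMod.natCast_zmod_val y]
    exact (ZMod.isUnit_iff_coprime y.val n).mpr h1
  have hg0 : Nat.gcd y.val n ≠ 0 := fun h0 => hn0 (Nat.eq_zero_of_gcd_eq_zero_right h0)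
  obtain ⟨e, he⟩ : Nat.gcd y.val n ∣ n := Nat.gcd_dvd_right _ _
  set g : ℕ := Nat.gcd y.val n with hg
  have hen : e ∣ n := ⟨g, by rw [he, mul_comm]⟩
  have he0 : e ≠ 0 := by rintro rfl; rw [mul_zero] at he; exact hn0 he
  haveI : NeZero e := ⟨he0⟩
  have heltn : e < n := by
    have h2 : 2 ≤ g := by omega
    calc e < 2 * e := by omega
      _ ≤ g * e := Nat.mul_le_mul_right e h2
      _ = n := he.symm
  -- `ψ₁ψ₂` does not factor through `e`, so some `v ≡ 1 (mod e)` has `(ψ₁ψ₂)(v) ≠ 1`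
  have hnot : ¬(ψ₁ * ψ₂).FactorsThrough e := by
    intro hfac
    have hle : (ψ₁ * ψ₂).conductor ≤ e :=
      Nat.le_of_dvd (Nat.pos_of_ne_zero he0) (conductor_dvd_of_mem_conductorSet _ hfac)
    omega
  rw [factorsThrough_iff_ker_unitsMap hen, SetLike.not_le_iff_exists] at hnot
  obtain ⟨v, hvker, hvθ⟩ := hnot
  rw [MonoidHom.mem_ker] at hvker hvθ
  have hθv : (ψ₁ * ψ₂) (v : ZMod n) ≠ 1 := by
    intro h1
    apply hvθ
    ext
    rw [MulChar.coe_toUnitHom, h1, Units.val_one]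
  -- `v ≡ 1 (mod e)`
  have hv1 : (v : ZMod n).val ≡ 1 [MOD e] := by
    have h1 : (ZMod.cast (v : ZMod n) : ZMod e) = 1 := by
      rw [← ZMod.unitsMap_val hen v, hvker, Units.val_one]
    rw [ZMod.cast_eq_val] at h1
    have h1' : (((v : ZMod n).val : ℕ) : ZMod e) = ((1 : ℕ) : ZMod e) := by rw [h1, Nat.cast_one]
    exact (ZMod.natCast_eq_natCast_iff _ _ _).mp h1'
  -- hence `v · y = y`
  have hvy : (v : ZMod n) * y = y := by
    obtain ⟨y', hy'⟩ := hgy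
    have hmod : g * (v : ZMod n).val * y' ≡ g * 1 * y' [MOD g * e] :=
      (hv1.mul_left' g).mul_right y'
    rw [← he] at hmod
    have hcast := (ZMod.natCast_eq_natCast_iff _ _ _).mpr hmod
    push_cast at hcast
    rw [ZMod.natCast_zmod_val] at hcast
    calc (v : ZMod n) * y = (v : ZMod n) * (y.val : ZMod n) := by rw [ZMod.natCast_zmod_val]
      _ = (g : ZMod n) * (v : ZMod n) * (y' : ZMod n) := by rw [hy']; push_cast; ring
      _ = (g : ZMod n) * 1 * (y' : ZMod n) := hcast
      _ = (y.val : ZMod n) := by rw [hy']; push_cast; ring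
      _ = y := ZMod.natCast_zmod_val y
  -- conclude from the unit twist
  have key := shiftSum_unit_mul ψ₁ ψ₂ v y
  rw [hvy] at key
  have hzero : (1 - (ψ₁ * ψ₂) (v : ZMod n)) * shiftSum ψ₁ ψ₂ 1 y = 0 := by
    rw [sub_mul, one_mul, ← key, sub_self]
  rcases mul_eq_zero.mp hzero with h | h
  · exact absurd (sub_eq_zero.mp h).symm hθv
  · exact h

/-- **Primitive twist**: if `ψ₁ψ₂` is primitive mod `n` then
`∑_m ψ₁(m) ψ₂(m + y) = (ψ₁ψ₂)(y) · ∑_m ψ₁(m) ψ₂(m + 1)` for every residue `y` (for `(y, n) = 1`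
substitute `u = y v`, TeX l.1071; for `(y, n) > 1` both sides vanish).
[cite: BondarenkoHeap2026, Lemma 9 (proof), TeX l.1069–1075] -/
theorem shiftSum_eq_mul_apply_of_isPrimitive (ψ₁ ψ₂ : DirichletCharacter ℂ n)
    (hprim : (ψ₁ * ψ₂).IsPrimitive) (y : ZMod n) :
    shiftSum ψ₁ ψ₂ 1 y = (ψ₁ * ψ₂) y * shiftSum ψ₁ ψ₂ 1 1 := by
  by_cases hy : IsUnit y
  · have key := shiftSum_unit_mul ψ₁ ψ₂ hy.unit 1
    rw [mul_one, IsUnit.unit_spec] at key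
    exact key
  · rw [shiftSum_eq_zero_of_not_isUnit ψ₁ ψ₂ hprim hy, MulChar.map_nonunit _ hy, zero_mul]

end Twist

/-! ### D. The quadratic self-correlation `∑_{m mod s} χ(m)χ(m + r) = c_s(r)` -/

/-- **Odd prime level**: for the primitive quadratic character `χ` mod `p^n`, `p` odd (so `n = 1`),
`∑_{m mod p} χ(m)χ(m + r) = c_p(r)` (`= p − 1` if `p ∣ r`, `−1` otherwise: the case `ψ_p = χ_p`
of the proof of Lemma 9, "`∑*_u χ(u + r m̄)χ(u) = c_p(r)`", TeX l.1091–1095).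
[cite: BondarenkoHeap2026, Lemma 9 (proof), TeX l.1091–1095] -/
theorem shiftSum_quad_quad_primePow_eq_ramanujanSum {p n : ℕ} (hp : p.Prime) (hp2 : p ≠ 2)
    (hn : 0 < n) [NeZero (p ^ n)] (χ : DirichletCharacter ℂ (p ^ n)) (hprim : χ.IsPrimitive)
    (hquad : χ.IsQuadratic) (r : ℤ) :
    shiftSum χ χ 1 (r : ZMod (p ^ n)) = ramanujanSum (p ^ n) r := by
  obtain rfl : n = 1 := eq_one_of_isPrimitive_pow_odd hp hp2 hn χ hprim hquad
  haveI hF : Fact (p ^ 1).Prime := ⟨by rwa [pow_one]⟩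
  have h1lt : 1 < p ^ 1 := by rw [pow_one]; exact hp.one_lt
  have hχ1 : χ ≠ 1 := ne_one_of_isPrimitive h1lt hprim
  rw [shiftSum_def, sum_quad_quad_shift hquad hχ1 (σ := 1) (by norm_num) (r : ZMod (p ^ 1)),
    map_one, mul_one, Literature.NumberTheory.Sieve.ramanujanSum_prime hF.out r]
  by_cases hr : ((p ^ 1 : ℕ) : ℤ) ∣ r
  · rw [if_pos hr, if_pos ((ZMod.intCast_zmod_eq_zero_iff_dvd r (p ^ 1)).mpr hr)]
  · rw [if_neg hr, if_neg (fun h0 => hr ((ZMod.intCast_zmod_eq_zero_iff_dvd r (p ^ 1)).mp h0))]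

/-- **`∑_{m mod s} χ(m)χ(m + r) = c_s(r)`** for every odd modulus `s` carrying a primitive quadratic
character `χ` (such `s` is square-free) and every integer `r`: induction over the factorisation
of `s` (CRT, `shiftSum_eq_mul_of_coprime`; the local value at each odd prime;
multiplicativity of Ramanujan's sum). This is the `s_ψ`-part `∏_{p ∣ s_ψ} c_p(r) = c_{s_ψ}(r)` of
(30). [cite: BondarenkoHeap2026, Lemma 9 (proof), TeX l.1091–1100] -/
theorem shiftSum_quad_quad_eq_ramanujanSum :
    ∀ (s : ℕ) (_ : NeZero s) (χ : DirichletCharacter ℂ s), χ.IsPrimitive → χ.IsQuadratic →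
      Odd s → ∀ r : ℤ, shiftSum χ χ 1 (r : ZMod s) = ramanujanSum s r := by
  intro s
  induction s using Nat.recOnPrimePow with
  | zero => intro hs; exact (not_neZero.mpr rfl hs).elim
  | one =>
    intro _ χ _ _ _ r
    rw [shiftSum_level_one, Literature.NumberTheory.Sieve.ramanujanSum_one]
  | prime_pow_mul a p n hp hpa hn ih =>
    intro hs χ hprim hquad hodd r
    have ha : a ≠ 0 := fun ha => by rw [ha, mul_zero] at hs; exact not_neZero.mpr rfl hs
    haveI : NeZero a := ⟨ha⟩
    haveI : NeZero (p ^ n) := ⟨pow_ne_zero n hp.ne_zero⟩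
    have hcop : (p ^ n).Coprime a := Nat.Coprime.pow_left n (hp.coprime_iff_not_dvd.mpr hpa)
    obtain ⟨hpodd, haodd⟩ := Nat.odd_mul.mp hodd
    have hp2 : p ≠ 2 := by
      rintro rfl
      have : Odd 2 := (Nat.odd_pow_iff hn.ne').mp hpodd
      exact absurd this (by decide)
    have hmul := shiftSum_eq_mul_of_coprime hcop χ χ 1 (r : ZMod (p ^ n * a))
    rw [ZMod.cast_one (dvd_mul_right _ _), ZMod.cast_one (dvd_mul_left _ _),
      ZMod.cast_intCast (dvd_mul_right _ _), ZMod.cast_intCast (dvd_mul_left _ _)] at hmul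
    rw [hmul, shiftSum_quad_quad_primePow_eq_ramanujanSum hp hp2 hn (crtFst hcop χ)
        (isPrimitive_crtFst hcop hprim) (IsQuadratic.crtFst hcop hquad) r,
      ih inferInstance (crtSnd hcop χ) (isPrimitive_crtSnd hcop hprim)
        (IsQuadratic.crtSnd hcop hquad) haodd r,
      Literature.NumberTheory.Sieve.ramanujanSum_mul_of_coprime hcop r]

/-! ### E. The splitting `q = s_ψ · q_ψ` and the proof of (30)–(31) -/

/-- `gcd(1 mod b, b) = 1` (the gcd factor of `norm_shiftSum_quad_le_aux` at the residue `1`).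
[folklore] -/
private theorem gcd_val_one (b : ℕ) [NeZero b] : Nat.gcd (1 : ZMod b).val b = 1 := by
  rw [ZMod.val_one_eq_one_mod, ← Nat.gcd_rec, Nat.gcd_one_right]

/-- `μ(a)² = 1` for square-free `a`. [folklore] -/
private theorem moebius_mul_self_of_squarefree {a : ℕ} (ha : Squarefree a) :
    (μ a : ℂ) * (μ a : ℂ) = 1 := by
  rw [ArithmeticFunction.moebius_apply_of_squarefree ha]
  push_cast
  rw [← pow_add, ← two_mul, pow_mul, neg_one_sq, one_pow]

/-- **Lemma 9, (30)–(31), at a given splitting `q = a · b` with `b = q_ψ = cond(χψ̄)`,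
`a = s_ψ`, `(a, b) = 1`.** [cite: BondarenkoHeap2026, Lemma 9, eq. (30)–(31), TeX l.1026–1100] -/
theorem lemma9_exact_aux {q : ℕ} [NeZero q] (hodd : Odd q) (hsf : Squarefree q)
    (χ : DirichletCharacter ℂ q) (hχp : χ.IsPrimitive) (hχq : χ.IsQuadratic)
    (ψ : DirichletCharacter ℂ q) (a b : ℕ) (hq : q = a * b) (hab : a.Coprime b)
    (hd : (χ * ψ⁻¹).conductor = b) :
    (∀ (r m : ℤ), IsCoprime m q →
        genJacobiSum χ ψ ((r : ZMod q) * (m : ZMod q)⁻¹) =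
          jacobiFactor χ ψ * jacobiTwist χ ψ (r : ZMod (jacobiConductor χ ψ)) *
            conj (jacobiTwist χ ψ (m : ZMod (jacobiConductor χ ψ))) *
            ramanujanSum (jacobiComplement χ ψ) r) ∧
      ‖jacobiFactor χ ψ‖ ≤ Real.sqrt (jacobiConductor χ ψ) ∧
      (ψ = 1 ∨ ψ = χ → ‖jacobiFactor χ ψ‖ ≤ 1) := by
  subst hq
  unfold jacobiFactor jacobiTwist jacobiComplement jacobiConductor
  obtain ⟨ha0, hb0⟩ := mul_ne_zero_iff.mp (NeZero.ne (a * b))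
  haveI : NeZero a := ⟨ha0⟩
  haveI : NeZero b := ⟨hb0⟩
  obtain ⟨haodd, hbodd⟩ := Nat.odd_mul.mp hodd
  have hsfa : Squarefree a := (Nat.squarefree_mul_iff.mp hsf).2.1
  set θ : DirichletCharacter ℂ (a * b) := χ * ψ⁻¹ with hθdef
  -- `s_ψ = a`
  have hcompl : a * b / θ.conductor = a := by
    rw [hd]; exact Nat.mul_div_cancel a (Nat.pos_of_ne_zero hb0)
  rw [hcompl]
  -- `θ` factors through `b`: trivial component mod `a`, primitive component `θ_b` mod `b`
  have hfac : θ.FactorsThrough b := by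
    have h := factorsThrough_conductor θ
    rwa [hd] at h
  have h1 : crtFst hab θ = 1 := crtFst_eq_one_of_factorsThrough hab hfac
  have hψa : crtFst hab ψ = crtFst hab χ := by
    rw [hθdef, crtFst_mul, crtFst_inv] at h1
    exact (mul_inv_eq_one.mp h1).symm
  have hθeq : θ = changeLevel (dvd_mul_left b a) (crtSnd hab θ) :=
    eq_changeLevel_crtSnd_of_crtFst_eq_one hab h1
  have hprimb : (crtSnd hab θ).IsPrimitive := by
    have h := (crtSnd hab θ).conductor_changeLevel (dvd_mul_left b a)
    rw [← hθeq, hd] at h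
    exact h.symm
  have hval : ∀ t : ℤ, θ.primitiveCharacter t = crtSnd hab θ t := fun t =>
    primitiveCharacter_apply_eq_of_eq_changeLevel (dvd_mul_left b a) hθeq hprimb t
  -- the two CRT factors of `f(t) = T_ψ(t)`
  have hχa : (crtFst hab χ).IsPrimitive := isPrimitive_crtFst hab hχp
  have hχa2 : (crtFst hab χ).IsQuadratic := IsQuadratic.crtFst hab hχq
  have hχb : (crtSnd hab χ).IsPrimitive := isPrimitive_crtSnd hab hχp
  have hχb2 : (crtSnd hab χ).IsQuadratic := IsQuadratic.crtSnd hab hχq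
  have hψa' : crtFst hab ψ⁻¹ = crtFst hab χ := by rw [crtFst_inv, hψa, hχa2.inv]
  have htwb : crtSnd hab ψ⁻¹ * crtSnd hab χ = crtSnd hab θ := by
    rw [← crtSnd_mul, hθdef, mul_comm ψ⁻¹ χ]
  have hprimb' : (crtSnd hab ψ⁻¹ * crtSnd hab χ).IsPrimitive := by rw [htwb]; exact hprimb
  set Fb : ℂ := shiftSum (crtSnd hab ψ⁻¹) (crtSnd hab χ) 1 1 with hFbdef
  have hFa : ∀ t : ℤ, shiftSum (crtFst hab ψ⁻¹) (crtFst hab χ) 1 (t : ZMod a) = ramanujanSum a t :=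
    fun t => by
      rw [hψa']
      exact shiftSum_quad_quad_eq_ramanujanSum a inferInstance (crtFst hab χ) hχa hχa2 haodd t
  have hFb : ∀ t : ℤ, shiftSum (crtSnd hab ψ⁻¹) (crtSnd hab χ) 1 (t : ZMod b) =
      crtSnd hab θ t * Fb := fun t => by
    rw [shiftSum_eq_mul_apply_of_isPrimitive _ _ hprimb' (t : ZMod b), htwb]
  have hsplit : ∀ t : ℤ, shiftSum ψ⁻¹ χ 1 (t : ZMod (a * b)) =
      ramanujanSum a t * (crtSnd hab θ t * Fb) := fun t => by
    have hmul := shiftSum_eq_mul_of_coprime hab ψ⁻¹ χ 1 (t : ZMod (a * b))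
    rw [ZMod.cast_one (dvd_mul_right _ _), ZMod.cast_one (dvd_mul_left _ _),
      ZMod.cast_intCast (dvd_mul_right _ _), ZMod.cast_intCast (dvd_mul_left _ _)] at hmul
    rw [hmul, hFa t, hFb t]
  -- `T_ψ(1) = μ(a) · Fb`, hence `J = μ(a)² Fb = Fb`
  have hμ : (μ a : ℂ) * (μ a : ℂ) = 1 := moebius_mul_self_of_squarefree hsfa
  have hT1 : genJacobiSum χ ψ 1 = (μ a : ℂ) * Fb := by
    have h := hsplit 1
    rw [Int.cast_one, Int.cast_one, map_one, one_mul,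
      Literature.NumberTheory.Sieve.ramanujanSum_one_right] at h
    rw [genJacobiSum_eq_shiftSum, h]
  have hJ : (μ a : ℂ) * genJacobiSum χ ψ 1 = Fb := by
    rw [hT1, ← mul_assoc, hμ, one_mul]
  rw [hJ]
  -- the bounds (31) at the modulus `b = q_ψ`
  have hbound := norm_shiftSum_quad_le_aux b inferInstance (crtSnd hab χ) hχb hχb2 hbodd
    (crtSnd hab ψ⁻¹) 1
  rw [gcd_val_one b, Nat.cast_one, one_mul] at hbound
  refine ⟨fun r m hm => ?_, ?_, fun hψ => ?_⟩
  · -- (30)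
    set u : (ZMod (a * b))ˣ := ZMod.unitOfIsCoprime m hm with hudef
    have hu : ((m : ℤ) : ZMod (a * b)) = (u : ZMod (a * b)) := rfl
    have huinv : ((m : ℤ) : ZMod (a * b))⁻¹ = ((u⁻¹ : (ZMod (a * b))ˣ) : ZMod (a * b)) := rfl
    have htwist : shiftSum ψ⁻¹ χ 1 ((r : ZMod (a * b)) * (m : ZMod (a * b))⁻¹) =
        conj (θ.primitiveCharacter m) * shiftSum ψ⁻¹ χ 1 (r : ZMod (a * b)) := by
      rw [huinv, mul_comm ((r : ℤ) : ZMod (a * b)), shiftSum_unit_mul, map_units_inv,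
        show ψ⁻¹ * χ = θ by rw [hθdef, mul_comm ψ⁻¹ χ], ← hu,
        θ.primitiveCharacter_apply_of_isCoprime hm, ← MulChar.inv_apply_eq_inv',
        Literature.NumberTheory.Sieve.LargeSieve.conj_apply_eq_inv_apply]
    rw [genJacobiSum_eq_shiftSum, htwist, hsplit r, hval r]
    ring
  · -- (31)
    rw [hd]
    exact hbound.1
  · -- `ψ ∈ {ψ₀, χ}`
    have hψ' : crtSnd hab ψ⁻¹ = 1 ∨ crtSnd hab ψ⁻¹ = crtSnd hab χ := by
      rcases hψ with rfl | rfl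
      · exact Or.inl (by rw [inv_one, crtSnd_one])
      · exact Or.inr (by rw [hχq.inv])
    exact hbound.2 hψ'

end JacobiSums

/-- **Bondarenko–Heap 2026, Lemma 9, eq. (30)–(31) — PROVED** (discharge of the named fact
`lemma9_exact` of `BondarenkoHeap2026Section6.lean`): for `q` odd and square-free, `χ` the
primitive quadratic character mod `q`, every `ψ` mod `q`, `r ≠ 0` and `(m, q) = 1`,
(30) `T_ψ(r m̄) = J_{q_ψ}(ψ) λ_ψ(r) conj(λ_ψ(m)) c_{s_ψ}(r)` with `q_ψ = cond(χψ̄)`, `s_ψ = q/q_ψ`,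
`λ_ψ` the primitive character inducing `χψ̄`, `J_{q_ψ}(ψ) = μ(s_ψ) T_ψ(1)`; (31)
`|J_{q_ψ}(ψ)| ≤ √q_ψ`; and `|J_{q_ψ}(ψ)| ≤ 1` for `ψ ∈ {ψ₀, χ}`. Road: module docstring (unit
twist; primitive twist; `∑_m χ(m)χ(m + r) = c_s(r)`; the splitting `q = s_ψ q_ψ`; the tree's CRT
Jacobi-sum bound `norm_shiftSum_quad_le_aux`). NOT RH-BEARING.
[cite: BondarenkoHeap2026, Lemma 9, eq. (30)–(31), TeX l.1026–1100] -/
theorem lemma9_exact_holds : lemma9_exact := by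
  intro q _ hodd hsf χ hχp hχq ψ
  obtain ⟨a, ha⟩ : (χ * ψ⁻¹).conductor ∣ q := conductor_dvd_level _
  have hq : q = a * (χ * ψ⁻¹).conductor := by rw [mul_comm]; exact ha
  have hcop : a.Coprime (χ * ψ⁻¹).conductor := by
    have hsf' : Squarefree (a * (χ * ψ⁻¹).conductor) := by rw [← hq]; exact hsf
    exact (Nat.squarefree_mul_iff.mp hsf').1
  obtain ⟨h1, h2, h3⟩ := JacobiSums.lemma9_exact_aux hodd hsf χ hχp hχq ψ a _ hq hcop rfl
  exact ⟨fun r m _ hm => h1 r m hm, h2, h3⟩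

end Literature.NumberTheory.LFunctions.BondarenkoHeap2026

end
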